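import Mathlib
import Summits.KontsevichZagierPeriods.Zeta5Search.WedgeDictionary
import HarnessLib

/-!
# XSAVE: the `p`-adic valuation of the closed scalar `ρ(a)` beyond `m₁` (cell `pub-zeta5`, TYPER g6 for census g6)

HONEST FRAMING: systematic search; no irrationality claim unless certified.

Census g6 typed (staging file `code/census/g6/lean/XSaveConjectures.lean`, not in the tree) the statement
`rhoVal_beyondM1`: for a prime `p ≠ 2` exceeding the fifteen `E`-pair differences `b₀−b_j−b_k` and
`b₁, b₄, b₅, b₆, b₇` (`b = b(a)`), the closed scalar
`ρ(a) = (−1)^{Σb_j} ∏_E (b₀−b_j−b_k)! / (4·b₁!b₄!b₅!b₆!b₇!·d!)` of the wedge dictionary (`WedgeDictionary.rhoOf`)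
has `v_p(ρ(a)) = −v_p(d!)`, `d = d(b(a))` — "the mechanism behind the D-laws" of STRUCTURE.md §10.  It is an
elementary consequence of the definition (every other factorial argument is `< p`), PROVED here
(`padicValRat_rhoOf`).  Nothing else of the XSAVE skeleton is asserted.
-/

open Finset

namespace Summit.KontsevichZagierPeriods.Zeta5Search.XSave

open Summit.KontsevichZagierPeriods.Zeta5Search.WedgeDictionary (rhoOf dOf Epairs)
open Literature.NumberTheory.Irrationality.BrownZudilin2022 (bOfA)

/-- `v_p(m!) = 0` for `m < p`. -/
theorem padicValNat_factorial_eq_zero {p m : ℕ} (hp : p.Prime) (h : m < p) : padicValNat p m.factorial = 0 := by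
  apply padicValNat.eq_zero_of_not_dvd
  rw [hp.dvd_factorial]
  omega

/-- `v_p` of a product of naturals vanishes when it vanishes on each factor (primality through non-divisibility). -/
theorem padicValNat_list_prod_eq_zero {p : ℕ} (hp : p.Prime) (l : List ℕ) (h : ∀ x ∈ l, ¬ p ∣ x) :
    padicValNat p l.prod = 0 := by
  apply padicValNat.eq_zero_of_not_dvd
  induction l with
  | nil => simpa using hp.one_lt.ne'  ∘ fun h => (Nat.dvd_one.1 h)
  | cons x t ih =>
    rw [List.prod_cons, hp.dvd_mul, not_or]
    exact ⟨h x (by simp), ih fun y hy => h y (by simp [hy])⟩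

/-- **`v_p(ρ(a)) = −v_p(d(b(a))!)`** for every prime `p ≠ 2` exceeding the fifteen `E`-pair differences
`b₀ − b_j − b_k` and the five entries `b₁, b₄, b₅, b₆, b₇` of `b = b(a)` (census g6's `rhoVal_beyondM1`; in the
dictionary's region all these twenty numbers are among Brown–Zudilin's 28 forms `h_i(a)`, so `p > m₁(a)` suffices). -/
theorem padicValRat_rhoOf (a : Fin 8 → ℤ) (p : ℕ) (hp : p.Prime) (hp2 : p ≠ 2)
    (hE : ∀ jk ∈ Epairs, (bOfA a 0 - bOfA a jk.1 - bOfA a jk.2).toNat < p)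
    (hJ : ∀ j ∈ ([1, 4, 5, 6, 7] : List ℕ), (bOfA a j).toNat < p) :
    padicValRat p (rhoOf a) = -((padicValNat p (dOf (bOfA a)).toNat.factorial : ℕ) : ℤ) := by
  haveI : Fact p.Prime := ⟨hp⟩
  -- the numerator and the `d`-free denominator as natural numbers
  set N : ℕ := (Epairs.map fun jk => (bOfA a 0 - bOfA a jk.1 - bOfA a jk.2).toNat.factorial).prod with hN
  set M : ℕ := (([1, 4, 5, 6, 7] : List ℕ).map fun j => (bOfA a j).toNat.factorial).prod with hM
  set D : ℕ := (dOf (bOfA a)).toNat.factorial with hD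
  have hrho : rhoOf a = ((-1 : ℚ) ^ (∑ j ∈ range 7, bOfA a (j + 1)).toNat * (N : ℚ)) / ((4 * M : ℕ) * (D : ℚ)) := by
    unfold rhoOf
    simp only [hN, hM, hD, Epairs, List.map, List.prod_cons, List.prod_nil]
    push_cast
    ring
  have hNpos : 0 < N := by
    rw [hN]; exact List.prod_pos fun x hx => by
      obtain ⟨jk, -, rfl⟩ := List.mem_map.1 hx; exact Nat.factorial_pos _
  have hMpos : 0 < M := by
    rw [hM]; exact List.prod_pos fun x hx => by
      obtain ⟨j, -, rfl⟩ := List.mem_map.1 hx; exact Nat.factorial_pos _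
  have hDpos : 0 < D := Nat.factorial_pos _
  -- valuations of the pieces
  have vN : padicValNat p N = 0 := by
    rw [hN]
    refine padicValNat_list_prod_eq_zero hp _ fun x hx => ?_
    obtain ⟨jk, hjk, rfl⟩ := List.mem_map.1 hx
    rw [hp.dvd_factorial]; have := hE jk hjk; omega
  have vM : padicValNat p (4 * M) = 0 := by
    rw [show 4 * M = ([4] ++ (([1, 4, 5, 6, 7] : List ℕ).map fun j => (bOfA a j).toNat.factorial)).prod by
      rw [List.prod_append, hM]; simp]
    refine padicValNat_list_prod_eq_zero hp _ fun x hx => ?_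
    rcases List.mem_append.1 hx with h4 | hx
    · simp only [List.mem_singleton] at h4
      subst h4
      intro h
      have h' : p ∣ 2 ^ 2 := by norm_num at h ⊢; exact h
      have := (Nat.prime_dvd_prime_iff_eq hp Nat.prime_two).1 (hp.dvd_of_dvd_pow h')
      exact hp2 this
    · obtain ⟨j, hj, rfl⟩ := List.mem_map.1 hx
      rw [hp.dvd_factorial]; have := hJ j hj; omega
  -- assemble
  have hNq : (N : ℚ) ≠ 0 := by exact_mod_cast hNpos.ne'
  have hsq : ((-1 : ℚ)) ^ (∑ j ∈ range 7, bOfA a (j + 1)).toNat ≠ 0 := pow_ne_zero _ (by norm_num)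
  have hnum : ((-1 : ℚ)) ^ (∑ j ∈ range 7, bOfA a (j + 1)).toNat * (N : ℚ) ≠ 0 := mul_ne_zero hsq hNq
  have h4M : ((4 * M : ℕ) : ℚ) ≠ 0 := by exact_mod_cast (show 4 * M ≠ 0 by omega)
  have hDq : (D : ℚ) ≠ 0 := by exact_mod_cast hDpos.ne'
  have hden : ((4 * M : ℕ) : ℚ) * (D : ℚ) ≠ 0 := mul_ne_zero h4M hDq
  have v1 : padicValRat p ((-1 : ℚ) ^ (∑ j ∈ range 7, bOfA a (j + 1)).toNat) = 0 := by
    rcases neg_one_pow_eq_or ℚ ((∑ j ∈ range 7, bOfA a (j + 1)).toNat) with h | h <;>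
      simp [h, padicValRat.neg]
  rw [hrho, padicValRat.div hnum hden, padicValRat.mul hsq hNq, padicValRat.mul h4M hDq, v1,
    padicValRat.of_nat, padicValRat.of_nat, padicValRat.of_nat, vN, vM]
  push_cast
  ring

end Summit.KontsevichZagierPeriods.Zeta5Search.XSave
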